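import Summits.Parity.GeneralizedHardyLittlewood.Theorems.LeeYangFibresAbsoluteUpgradeQuantClipAux
import HarnessLib

/-!
# Route `LeeYangFibres`, crux `AbsoluteUpgrade` (stmt-Parity-14116), line `dip-margin-rate-exchange`:
# the fibre clipping lemma with a margin (helper for the stub `stub_quantClip`)

Helper file 2/· for the registered stub `stub_quantClip`.  For ONE scale — fixed cell data `C_j ≥ 0` on the box
`[1,u]^t` obeying the cell-parity law with Walsh amplitudes `θ_S` (`|θ_S| ≤ 2`), model densities `a_n ≥ 0`
(`Σ_n a_n ≤ 1`, `a_1 > 0`) whose rescalings `a_n κ` follow abstract densities `I_{n-1}` to relative accuracy `εa`,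
real-rooted fibres through a coordinate `i`, and the margin statement for `I` at threshold `ϑ` — we prove:

* `quantClip_balance` — the parity balance `|Σ_n (-1)^{n+1} a_n| ≤ (1/4) Σ_n a_n` of the model densities from the
  balance `|Σ_n (-1)^n I_{n-1}| ≤ 1/(u-1)` of the abstract densities (`u ≥ 16`, `εa ≤ 1/100`, `Σ I ≥ I_0 ≥ 1`);
* `quantClip_fibreClip` (registered helper) — VERBATIM the interpolation of `HyperbolicityClipsParity.fibre_clip`
  (nodes `w_k ∈ {a_1/3, 1}`, `ρ(a_1/3) ≥ 1/2`, `|ρ(1)| ≤ 1/4`, `multiaffine_coeff_bound` with `d = 1/4`) with the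
  Newton step `beta_bound` replaced by the margin step `quantClip_marginBeta`:
  `|θ_{T ∪ {i}}| ≤ 8^{t-1} (2^t ϑ + 4 ν₀)` for all `T ⊆ [t] ∖ {i}`;
* `quantClip_thetaSmall` — over all coordinates: `|θ_S| ≤ 8^{t-1} (2^t ϑ + 4 ν₀)` for every `S ≠ ∅`.

No named facts are used.
-/

noncomputable section

namespace Summit.Parity.GeneralizedHardyLittlewood.Cruxes.AbsoluteUpgrade.DipMarginRateExchange

open scoped BigOperators
open Finset
open Summit.Parity.GeneralizedHardyLittlewood.Theorems.HyperbolicityClipsParity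

/-! ## Parity balance of the model densities from the balance of the abstract densities -/

/-- **Parity balance transfer.**  If `a_n κ` is within relative `εa ≤ 1/100` of `I_{n-1} ≥ 0` (`1 ≤ n ≤ u`,
`I_0 ≥ 1`) and `|Σ_{n=1}^u (-1)^n I_{n-1}| ≤ 1/(u-1)` with `u ≥ 16`, then
`|Σ_{n=1}^u (-1)^{n+1} a_n| ≤ (1/4) Σ_{n=1}^u a_n`. -/
theorem quantClip_balance {u : ℕ} (hu : 16 ≤ u) (a I : ℕ → ℝ) (hI : ∀ j, 0 ≤ I j) (hI0 : 1 ≤ I 0)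
    {κ εa : ℝ} (hκ : 0 < κ) (hεa : εa ≤ 1 / 100)
    (hanat : ∀ n ∈ Finset.Icc 1 u, |a n * κ - I (n - 1)| ≤ εa * I (n - 1))
    (hIbal : |∑ n ∈ Finset.Icc 1 u, (-1 : ℝ) ^ n * I (n - 1)| ≤ 1 / ((u : ℝ) - 1)) :
    |∑ n ∈ Finset.Icc 1 u, (-1 : ℝ) ^ (n + 1) * a n| ≤ 1 / 4 * ∑ n ∈ Finset.Icc 1 u, a n := by
  have hu' : (16 : ℝ) ≤ u := by exact_mod_cast hu
  have hSI0 : 0 ≤ ∑ n ∈ Finset.Icc 1 u, I (n - 1) := Finset.sum_nonneg fun n _ => hI _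
  have hSI : 1 ≤ ∑ n ∈ Finset.Icc 1 u, I (n - 1) := by
    have h := Finset.single_le_sum (f := fun n => I (n - 1)) (fun n _ => hI _)
      (Finset.mem_Icc.2 ⟨le_refl 1, by omega⟩ : (1 : ℕ) ∈ Finset.Icc 1 u)
    exact le_trans hI0 h
  -- numerator after multiplying by `κ`
  have key1 : |∑ n ∈ Finset.Icc 1 u, (-1 : ℝ) ^ (n + 1) * (a n * κ)| ≤
      εa * (∑ n ∈ Finset.Icc 1 u, I (n - 1)) + 1 / ((u : ℝ) - 1) := by
    have hsplit : ∑ n ∈ Finset.Icc 1 u, (-1 : ℝ) ^ (n + 1) * (a n * κ) =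
        ∑ n ∈ Finset.Icc 1 u, (-1 : ℝ) ^ (n + 1) * (a n * κ - I (n - 1)) +
          -∑ n ∈ Finset.Icc 1 u, (-1 : ℝ) ^ n * I (n - 1) := by
      rw [← Finset.sum_neg_distrib, ← Finset.sum_add_distrib]
      refine Finset.sum_congr rfl fun n _ => ?_
      rw [pow_succ]
      ring
    rw [hsplit]
    refine (abs_add_le _ _).trans (add_le_add ?_ ?_)
    · refine (Finset.abs_sum_le_sum_abs _ _).trans ?_
      rw [Finset.mul_sum]
      refine Finset.sum_le_sum fun n hn => ?_
      rw [abs_mul, abs_pow, abs_neg, abs_one, one_pow, one_mul]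
      exact hanat n hn
    · rw [abs_neg]
      exact hIbal
  -- denominator after multiplying by `κ`
  have key2 : (1 - εa) * ∑ n ∈ Finset.Icc 1 u, I (n - 1) ≤ ∑ n ∈ Finset.Icc 1 u, a n * κ := by
    rw [Finset.mul_sum]
    refine Finset.sum_le_sum fun n hn => ?_
    have := (abs_le.1 (hanat n hn)).1
    linarith
  -- compare
  have hmul1 : (∑ n ∈ Finset.Icc 1 u, (-1 : ℝ) ^ (n + 1) * a n) * κ =
      ∑ n ∈ Finset.Icc 1 u, (-1 : ℝ) ^ (n + 1) * (a n * κ) := by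
    rw [Finset.sum_mul]
    exact Finset.sum_congr rfl fun n _ => by ring
  have hmul2 : (1 / 4 * ∑ n ∈ Finset.Icc 1 u, a n) * κ = 1 / 4 * ∑ n ∈ Finset.Icc 1 u, a n * κ := by
    rw [mul_assoc, Finset.sum_mul]
  refine le_of_mul_le_mul_right ?_ hκ
  rw [← abs_of_pos hκ, ← abs_mul, abs_of_pos hκ, hmul1, hmul2]
  have h15 : 1 / ((u : ℝ) - 1) ≤ 1 / 15 := one_div_le_one_div_of_le (by norm_num) (by linarith)
  have hεS : εa * (∑ n ∈ Finset.Icc 1 u, I (n - 1)) ≤ 1 / 100 * ∑ n ∈ Finset.Icc 1 u, I (n - 1) :=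
    mul_le_mul_of_nonneg_right hεa hSI0
  nlinarith [key1, key2, hSI]

/-! ## The fibre clipping lemma with a margin -/

/-- **Every amplitude through `i` is clipped (margin version of `HyperbolicityClipsParity.fibre_clip`).**  With
all fibres through `i` real-rooted, the frozen fugacities `w_k ∈ {a₁/3, 1}` realise the two-point grid
`{ρ(a₁/3), ρ(1)}^U` (`ρ = F̃/F ∈ [-1,1]`, `ρ(a₁/3) ≥ 1/2`, `|ρ(1)| ≤ 1/4` by parity balance) on which the
multiaffine form `Σ_{T ⊆ U} θ_{T ∪ {i}} ∏_{k ∈ T} ρ_k = β/Π` is bounded by `2^t ϑ + 4 ν₀` (`quantClip_marginBeta`);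
interpolation (`multiaffine_coeff_bound`, `d = 1/4`) gives `|θ_{T ∪ {i}}| ≤ 8^{t-1}(2^t ϑ + 4 ν₀)`. -/
theorem quantClip_fibreClip : ∀ {t u : ℕ} (i : Fin t), 2 ≤ u → ∀ θ : Finset (Fin t) → ℝ, (∀ S, |θ S| ≤ 2) → ∀ a : ℕ → ℝ, (∀ n, 0 ≤ a n) → 0 < a 1 → ∑ n ∈ Finset.Icc 1 u, a n ≤ 1 → ∀ {εb : ℝ}, εb ≤ 1 / 4 → |∑ n ∈ Finset.Icc 1 u, (-1 : ℝ) ^ (n + 1) * a n| ≤ εb * ∑ n ∈ Finset.Icc 1 u, a n → ∀ I : ℕ → ℝ, (∀ j, 0 ≤ I j) → 1 ≤ I 0 → 1 / 2 ≤ I 1 → ∀ {κ εa : ℝ}, 0 < κ → εa ≤ 1 / 2 → (∀ n ∈ Finset.Icc 1 u, |a n * κ - I (n - 1)| ≤ εa * I (n - 1)) → ∀ C : (Fin t → ℕ) → ℝ, (∀ j, 0 ≤ C j) → ∀ {M : ℝ}, 0 < M → ∀ {E₀ : ℝ}, 0 ≤ E₀ → (∀ j ∈ Fintype.piFinset (fun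 _ : Fin t => Finset.Icc 1 u), |C j - (∑ S : Finset (Fin t), θ S * ∏ k ∈ S, (-1 : ℝ) ^ (j k + 1)) * (M * ∏ k, a (j k))| ≤ E₀) → (∀ w : Fin t → ℝ, (∀ k, 0 < w k ∧ w k ≤ 1) → ∀ z : ℂ, (∑ j ∈ Fintype.piFinset (fun _ : Fin t => Finset.Icc 1 u), (C j : ℂ) * ∏ k, (if k = i then z else ((w k : ℝ) : ℂ)) ^ (j k)) = 0 → z.im = 0) → ∀ {ϑ r f ν₀ : ℝ}, 0 < ϑ → 0 ≤ ν₀ → (∀ θ' : ℝ, ϑ ≤ |θ'| → |θ'| ≤ 2 → ∀ b : ℕ → ℝ, (∀ j : ℕ, j < u → 0 ≤ b j) → (∀ j : ℕ, j < u → |b j - (1 + θ' * (-1) ^ j) * I j| ≤ r * I j + f) → ∃ z : ℂ, (∑ j ∈ Finset.range u, (b j : ℂ) * z ^ j) = 0 ∧ z.im ≠ 0) → 3 * εa ≤ r → 4 * ν₀ ≤ ϑ → ν₀ ≤ ϑ * f → E₀ * (u : ℝ) ^ (t - 1) * κ ≤ ν₀ * M * a 1 ^ (t - 1) → ∀ T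 ∈ (Finset.univ.erase i).powerset, |θ (insert i T)| ≤ 8 ^ (t - 1) * (2 ^ t * ϑ + 4 * ν₀) := by
  intro t u i hu θ hθ a ha ha1 hsum εb hεb hbal I hI hI0 hI1 κ εa hκ hεa hanat C hC M hM E₀ hE₀ hlaw hhyp
    ϑ r f ν₀ hϑ hν₀ hmargin hr hν₁ hν₂ hsmall
  have hu1 : 1 ≤ u := le_trans one_le_two hu
  have hcard : (Finset.univ.erase i).card = t - 1 := by
    rw [Finset.card_erase_of_mem (Finset.mem_univ i), Finset.card_univ, Fintype.card_fin]
  -- the two nodes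
  obtain ⟨hF0pos, hF0le⟩ := node_estimate hu1 ha ha1 hsum
  have hF1 : ∑ n ∈ Finset.Icc 1 u, a n * (1 : ℝ) ^ n = ∑ n ∈ Finset.Icc 1 u, a n :=
    Finset.sum_congr rfl fun n _ => by rw [one_pow, mul_one]
  have hFt1 : ∑ n ∈ Finset.Icc 1 u, (-1 : ℝ) ^ (n + 1) * a n * (1 : ℝ) ^ n =
      ∑ n ∈ Finset.Icc 1 u, (-1 : ℝ) ^ (n + 1) * a n :=
    Finset.sum_congr rfl fun n _ => by rw [one_pow, mul_one]
  have hF1pos : 0 < ∑ n ∈ Finset.Icc 1 u, a n * (1 : ℝ) ^ n := by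
    have := a_one_mul_le_F hu1 ha (zero_le_one (α := ℝ))
    rw [mul_one] at this
    exact lt_of_lt_of_le ha1 this
  set n₀ : ℝ := (∑ n ∈ Finset.Icc 1 u, (-1 : ℝ) ^ (n + 1) * a n * (a 1 / 3) ^ n) /
    ∑ n ∈ Finset.Icc 1 u, a n * (a 1 / 3) ^ n with hn₀_def
  set n₁ : ℝ := (∑ n ∈ Finset.Icc 1 u, (-1 : ℝ) ^ (n + 1) * a n * (1 : ℝ) ^ n) /
    ∑ n ∈ Finset.Icc 1 u, a n * (1 : ℝ) ^ n with hn₁_def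
  have hn₀ : |n₀| ≤ 1 := by
    rw [hn₀_def, abs_div, abs_of_pos hF0pos, div_le_one hF0pos]
    exact abs_Ftilde_le_F ha (by positivity)
  have hn₁ : |n₁| ≤ 1 := by
    rw [hn₁_def, abs_div, abs_of_pos hF1pos, div_le_one hF1pos]
    exact abs_Ftilde_le_F ha zero_le_one
  have hn₀ge : 1 / 2 ≤ n₀ := by
    rw [hn₀_def, le_div_iff₀ hF0pos]; linarith
  have hn₁le : |n₁| ≤ 1 / 4 := by
    rw [hn₁_def, abs_div, abs_of_pos hF1pos, div_le_iff₀ hF1pos, hF1, hFt1]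
    exact hbal.trans (mul_le_mul_of_nonneg_right hεb (Finset.sum_nonneg fun n _ => ha n))
  have hsep : (1 / 4 : ℝ) ≤ |n₀ - n₁| := by
    have h := abs_le.1 hn₁le
    rw [abs_of_nonneg (by linarith)]
    linarith
  -- the grid bound
  have hgrid : ∀ x : Fin t → ℝ, (∀ k ∈ Finset.univ.erase i, x k = n₀ ∨ x k = n₁) →
      |∑ T ∈ (Finset.univ.erase i).powerset, θ (insert i T) * ∏ k ∈ T, x k| ≤ 2 ^ t * ϑ + 4 * ν₀ := by
    intro x hx
    let w : Fin t → ℝ := fun k => if x k = n₀ then a 1 / 3 else 1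
    have ha1le : a 1 ≤ 1 :=
      (Finset.single_le_sum (f := a) (fun n _ => ha n) (Finset.mem_Icc.2 ⟨le_refl 1, hu1⟩)).trans hsum
    have hw : ∀ k, 0 < w k ∧ w k ≤ 1 := by
      intro k
      by_cases hxk : x k = n₀
      · have : w k = a 1 / 3 := if_pos hxk
        rw [this]; constructor <;> linarith
      · have : w k = 1 := if_neg hxk
        rw [this]; exact ⟨one_pos, le_rfl⟩
    have hβ := quantClip_marginBeta i hu θ hθ a ha ha1 I hI hI0 hI1 hκ hεa hanat C hC hM hE₀ hlaw w hw
      (hhyp w hw) hϑ hν₀ hmargin hr hν₁ hν₂ hsmall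
    have hFpos : ∀ k, 0 < ∑ n ∈ Finset.Icc 1 u, a n * w k ^ n := fun k =>
      lt_of_lt_of_le (mul_pos ha1 (hw k).1) (a_one_mul_le_F hu1 ha (hw k).1.le)
    have hρ : ∀ k ∈ Finset.univ.erase i, x k * ∑ n ∈ Finset.Icc 1 u, a n * w k ^ n =
        ∑ n ∈ Finset.Icc 1 u, (-1 : ℝ) ^ (n + 1) * a n * w k ^ n := by
      intro k hk
      by_cases hxk : x k = n₀
      · have hwk : w k = a 1 / 3 := if_pos hxk
        rw [hwk, hxk, hn₀_def]; exact div_mul_cancel₀ _ hF0pos.ne'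
      · have hwk : w k = 1 := if_neg hxk
        have hxk' : x k = n₁ := (hx k hk).resolve_left hxk
        rw [hwk, hxk', hn₁_def]; exact div_mul_cancel₀ _ hF1pos.ne'
    have hβeq : ∑ T ∈ (Finset.univ.erase i).powerset, θ (insert i T) * ∏ k ∈ Finset.univ.erase i,
        ∑ n ∈ Finset.Icc 1 u, (if k ∈ T then (-1 : ℝ) ^ (n + 1) else 1) * a n * w k ^ n =
        (∑ T ∈ (Finset.univ.erase i).powerset, θ (insert i T) * ∏ k ∈ T, x k) *
          ∏ k ∈ Finset.univ.erase i, ∑ n ∈ Finset.Icc 1 u, a n * w k ^ n := by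
      rw [Finset.sum_mul]
      refine Finset.sum_congr rfl fun T hT => ?_
      rw [prod_G_eq_prod_rho_mul (Finset.univ.erase i) T (Finset.mem_powerset.1 hT) a w x hρ]
      ring
    have hPipos : 0 < ∏ k ∈ Finset.univ.erase i, ∑ n ∈ Finset.Icc 1 u, a n * w k ^ n :=
      Finset.prod_pos fun k _ => hFpos k
    rw [hβeq, abs_mul, abs_of_pos hPipos] at hβ
    exact le_of_mul_le_mul_right hβ hPipos
  -- interpolation
  intro T hT
  have h := multiaffine_coeff_bound (by norm_num : (0 : ℝ) < 1 / 4) hsep hn₀ hn₁ (2 ^ t * ϑ + 4 * ν₀)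
    (Finset.univ.erase i) (fun T => θ (insert i T)) hgrid T hT
  rw [hcard, show (2 : ℝ) / (1 / 4) = 8 by norm_num] at h
  exact h

/-- **Clipping through every coordinate (margin version).**  Under the hypotheses of `quantClip_fibreClip` for
EVERY coordinate `i` (all fibres real-rooted), with the parity balance derived from the balance of the abstract
densities (`quantClip_balance`: `u ≥ 16`, `εa ≤ 1/100`, `|Σ_n (-1)^n I_{n-1}| ≤ 1/(u-1)`), every non-empty Walsh
amplitude is clipped: `|θ_S| ≤ 8^{t-1} (2^t ϑ + 4 ν₀)` for `S ≠ ∅`. -/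
theorem quantClip_thetaSmall {t u : ℕ} (hu : 16 ≤ u) (θ : Finset (Fin t) → ℝ) (hθ : ∀ S, |θ S| ≤ 2)
    (a : ℕ → ℝ) (ha : ∀ n, 0 ≤ a n) (ha1 : 0 < a 1) (hsum : ∑ n ∈ Finset.Icc 1 u, a n ≤ 1)
    (I : ℕ → ℝ) (hI : ∀ j, 0 ≤ I j) (hI0 : 1 ≤ I 0) (hI1 : 1 / 2 ≤ I 1)
    (hIbal : |∑ n ∈ Finset.Icc 1 u, (-1 : ℝ) ^ n * I (n - 1)| ≤ 1 / ((u : ℝ) - 1))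
    {κ εa : ℝ} (hκ : 0 < κ) (hεa : εa ≤ 1 / 100)
    (hanat : ∀ n ∈ Finset.Icc 1 u, |a n * κ - I (n - 1)| ≤ εa * I (n - 1))
    (C : (Fin t → ℕ) → ℝ) (hC : ∀ j, 0 ≤ C j) {M : ℝ} (hM : 0 < M) {E₀ : ℝ} (hE₀ : 0 ≤ E₀)
    (hlaw : ∀ j ∈ Fintype.piFinset (fun _ : Fin t => Finset.Icc 1 u),
      |C j - (∑ S : Finset (Fin t), θ S * ∏ k ∈ S, (-1 : ℝ) ^ (j k + 1)) * (M * ∏ k, a (j k))| ≤ E₀)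
    (hhyp : ∀ i : Fin t, ∀ w : Fin t → ℝ, (∀ k, 0 < w k ∧ w k ≤ 1) → ∀ z : ℂ,
      (∑ j ∈ Fintype.piFinset (fun _ : Fin t => Finset.Icc 1 u),
        (C j : ℂ) * ∏ k, (if k = i then z else ((w k : ℝ) : ℂ)) ^ (j k)) = 0 → z.im = 0)
    {ϑ r f ν₀ : ℝ} (hϑ : 0 < ϑ) (hν₀ : 0 ≤ ν₀)
    (hmargin : ∀ θ' : ℝ, ϑ ≤ |θ'| → |θ'| ≤ 2 → ∀ b : ℕ → ℝ, (∀ j : ℕ, j < u → 0 ≤ b j) →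
      (∀ j : ℕ, j < u → |b j - (1 + θ' * (-1) ^ j) * I j| ≤ r * I j + f) →
      ∃ z : ℂ, (∑ j ∈ Finset.range u, (b j : ℂ) * z ^ j) = 0 ∧ z.im ≠ 0)
    (hr : 3 * εa ≤ r) (hν₁ : 4 * ν₀ ≤ ϑ) (hν₂ : ν₀ ≤ ϑ * f)
    (hsmall : E₀ * (u : ℝ) ^ (t - 1) * κ ≤ ν₀ * M * a 1 ^ (t - 1)) :
    ∀ S : Finset (Fin t), S ≠ ∅ → |θ S| ≤ 8 ^ (t - 1) * (2 ^ t * ϑ + 4 * ν₀) := by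
  have hbal := quantClip_balance hu a I hI hI0 hκ hεa hanat hIbal
  have hεa' : εa ≤ 1 / 2 := hεa.trans (by norm_num)
  refine theta_small_of_fibres θ fun i => ?_
  exact quantClip_fibreClip i (le_trans (by norm_num) hu) θ hθ a ha ha1 hsum (le_refl (1 / 4 : ℝ)) hbal
    I hI hI0 hI1 hκ hεa' hanat C hC hM hE₀ hlaw (hhyp i) hϑ hν₀ hmargin hr hν₁ hν₂ hsmall

end Summit.Parity.GeneralizedHardyLittlewood.Cruxes.AbsoluteUpgrade.DipMarginRateExchange

end
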